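import Literature.AlgebraicGeometry.Motives.HirschowitzIyerGenericStrongLine
import Literature.AlgebraicGeometry.Motives.CartierDivisorIntersectionCycle
import Literature.AlgebraicGeometry.Motives.ProjectiveSpaceFieldPointsBijective
import Literature.AlgebraicGeometry.Motives.CurvePlaces
import HarnessLib

/-!
# The generic strong line of a curve on `V₊(Q, C) ⊂ ℙ⁸` (Hirschowitz–Iyer Lemma 2.2, `s = 0`: the family over `K(W)`)

Hirschowitz–Iyer 2010, proof of Lemma 2.2 for `s < r` (here `s = 0`, `r = 1`): "we start by
choosing carefully an algebraic family `(H_z ⊂ H'_z)_{z ∈ Z}` of strong `s`-planes covering `W` […]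
By standard arguments, we may suppose that `Z` is projective smooth connected of dimension `r - s`."
For a curve `W = closure {w}` on `Y = V₊(Q, C)` the "careful choice" is made at the generic point:
this file produces the function field `F = K(W)` with its `K`-algebra structure, the `F`-valued
point `p_w` of `ℙ⁸` lying over `w` (homogeneous coordinates of the generic point of `W`), the
equations `Q(p_w) = C(p_w) = 0`, and — from `StrongLineCover.exists_fatFlag_over_finite_extension`
— a finite extension `F'/F` carrying a `3`-fat (strong) line `span(u, v) ∋ p_w` with witness plane
`span(u, v, y)`. The parameter curve `Z` of the printed proof is then the normalisation of `W` in
`F'` (sequel).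

* `curveOf w`, `curveField w` — `W = closure {w}` as a closed subvariety of `Y`, over `K`, and
  its function field `F = K(W)` (a `K`-algebra through `Motives.RatFn.algebraStalk`);
* `genericAlgPoint w : Y(F)` — the `F`-point `Spec K(W) → W → Y` (over `K` by
  `CurvePlaces.fromSpecStalk_comp_hom`), with `genericAlgPoint_pt : (genericAlgPoint w).pt = w`;
* `exists_coords` — homogeneous coordinates `p_w ∈ F⁹ ∖ 0` of that point in `ℙ⁸`, with
  `Q(p_w) = C(p_w) = 0`;
* `exists_genericStrongLine` — **the generic strong line**: a finite extension `F' ⊆ F̄` of `F`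
  and a fat flag `(u, v, y)` over `F'` with `p_w = α u + β v`.

## References

* A. Hirschowitz, J. N. N. Iyer, Contemp. Math. 522 (2010), arXiv:0903.5018, §2 Lemma 2.2 (proof,
  case `s < r`). [HirschowitzIyer2010]
* R. Hartshorne, *Algebraic Geometry*, II Ex. 2.7 (field-valued points). [Hartshorne1977]
-/

noncomputable section

open CategoryTheory AlgebraicGeometry Order MvPolynomial

universe u

namespace Literature.AlgebraicGeometry.Motives

attribute [local instance] MvPolynomial.gradedAlgebra

/-! ### The curve `W = closure {w}` and the `K(W)`-point over `w` -/

section Curve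

variable {K : Type u} [Field K] {Y : SchemeOver K} [IsIntegral Y.left] (w : Y.left)

/-- The curve (closed subvariety) `W = closure {w} ⊆ Y`, over `K`. [folklore] -/
abbrev curveOf : SchemeOver K := (ClosedSubvariety.ofPoint Y.left w).over Y.hom

/-- Its function field `F = K(W)` (a `K`-algebra). [folklore] -/
abbrev curveField : Type u := (curveOf w).left.functionField

/-- **The `K(W)`-point of `Y` over `w`**: `Spec K(W) → W ↪ Y`. [cite: Hartshorne1977, II Ex. 2.7] -/
def genericAlgPoint : AlgPoints Y (curveField w) :=
  AlgPoints.mk ((curveOf w).left.fromSpecStalk (genericPoint (curveOf w).left) ≫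
      (ClosedSubvariety.ofPoint Y.left w).ι) (by
    rw [Category.assoc]
    exact CurvePlaces.fromSpecStalk_comp_hom (curveOf w) (genericPoint (curveOf w).left))

omit [IsIntegral Y.left] in
/-- The underlying point of an `L`-point is the image of the closed point (`rfl`). [folklore] -/
theorem AlgPoints.pt_eq_base {L : Type u} [Field L] [Algebra K L] (P : AlgPoints Y L) :
    P.pt = P.left.base (IsLocalRing.closedPoint L) := rfl

omit [IsIntegral Y.left] in
/-- The `K(W)`-point lies over `w`. [folklore] -/
theorem genericAlgPoint_pt : (genericAlgPoint w).pt = w := by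
  rw [AlgPoints.pt_eq_base]
  change ((curveOf w).left.fromSpecStalk (genericPoint (curveOf w).left) ≫
      (ClosedSubvariety.ofPoint Y.left w).ι).base (IsLocalRing.closedPoint (curveField w)) = w
  rw [Scheme.Hom.comp_base, TopCat.coe_comp, Function.comp_apply, Scheme.fromSpecStalk_closedPoint]
  exact ClosedSubvariety.genericPoint_ofPoint w

end Curve

/-! ### Coordinates of the generic point of a curve on `V₊(Q, C)` and its generic strong line -/

section QuadricCubic

variable {K : Type u} [Field K] {Q C : MvPolynomial (Fin (8 + 1)) K}

/-- **Homogeneous coordinates of the generic point of a curve on `V₊(Q, C) ⊂ ℙ⁸`**: a non-zero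
`p ∈ K(W)⁹` with `[p] = ` the `K(W)`-point over `w` in `ℙ⁸` and `Q(p) = C(p) = 0`.
[cite: Hartshorne1977, II Ex. 2.7 and Thm. 7.1] -/
theorem exists_coords (hQ : Q.IsHomogeneous 2) (hC : C.IsHomogeneous 3) (w : ↥(quadricCubic Q C).left) :
    ∃ (p : Fin (8 + 1) → curveField w) (hp : p ≠ 0),
      ProjectiveSpace.pointOfVec K p hp = AlgPoints.map (completeIntersectionι ![Q, C]) (genericAlgPoint w) ∧
      MvPolynomial.eval p (MvPolynomial.map (algebraMap K (curveField w)) Q) = 0 ∧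
      MvPolynomial.eval p (MvPolynomial.map (algebraMap K (curveField w)) C) = 0 := by
  set iY := completeIntersectionι ![Q, C] with hiY
  obtain ⟨p, hp, hP⟩ := ProjectiveSpace.exists_eq_pointOfVec (AlgPoints.map iY (genericAlgPoint w))
  refine ⟨p, hp, hP.symm, ?_⟩
  have hV : Set.range iY.left.base =
      ProjectiveSpectrum.zeroLocus (MvPolynomial.homogeneousSubmodule (Fin (8 + 1)) K) (Set.range ![Q, C]) :=
    range_completeIntersectionι _
  have hmem : (ProjectiveSpace.pointOfVec K p hp).pt ∈
      ProjectiveSpectrum.zeroLocus (MvPolynomial.homogeneousSubmodule (Fin (8 + 1)) K) (Set.range ![Q, C]) := by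
    rw [← hP, AlgPoints.pt_map, ← hV]; exact ⟨_, rfl⟩
  have hF : ∀ j, MvPolynomial.eval p (MvPolynomial.map (algebraMap K (curveField w)) (![Q, C] j)) = 0 := by
    intro j
    have hdeg : 0 < (![2, 3] : Fin 2 → ℕ) j := by fin_cases j <;> norm_num
    have hhom : (![Q, C] j).IsHomogeneous ((![2, 3] : Fin 2 → ℕ) j) := by fin_cases j <;> assumption
    have hj : (ProjectiveSpace.pointOfVec K p hp).pt ∈
        ProjectiveSpectrum.zeroLocus (MvPolynomial.homogeneousSubmodule (Fin (8 + 1)) K) {![Q, C] j} :=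
      (ProjectiveSpectrum.mem_zeroLocus _ _ _).mpr
        ((Set.singleton_subset_iff.mpr (Set.mem_range_self j)).trans
          ((ProjectiveSpectrum.mem_zeroLocus _ _ _).mp hmem))
    have h := (ProjectiveSpace.pt_pointOfVec_mem_zeroLocus_iff p hp hdeg
      ((mem_homogeneousSubmodule _ _).mpr hhom)).mp hj
    rwa [MvPolynomial.aeval_def, ← MvPolynomial.eval_map] at h
  exact ⟨hF 0, hF 1⟩

/-- **The generic strong line of a curve on `V₊(Q, C) ⊂ ℙ⁸`** (Hirschowitz–Iyer, proof of Lemma 2.2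
for `s = 0 < r = 1`: the family `(H_z ⊂ H'_z)_{z ∈ Z}` at the generic point of `Z`): for `K` of
characteristic zero, a quadric `Q`, a cubic `C` and a point `w` of `V₊(Q, C)`, there are homogeneous
coordinates `p ∈ K(W)⁹` of the generic point of `W = closure {w}`, a finite extension `F'` of `K(W)`
and a `3`-fat line `span(u, v) ∋ p` with witness plane `span(u, v, y)` defined over `F'`
(`Q ≡ 0` on the plane, `C(c₀u + c₁v + c₂y) = c₂³ C(y)`).
[cite: HirschowitzIyer2010, §2 Lemma 2.2 (proof) with §6 Prop. 6.1] -/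
theorem exists_genericStrongLine [CharZero K] (hQ : Q.IsHomogeneous 2) (hC : C.IsHomogeneous 3)
    (w : ↥(quadricCubic Q C).left) :
    ∃ (p : Fin (8 + 1) → curveField w) (hp : p ≠ 0),
      ProjectiveSpace.pointOfVec K p hp = AlgPoints.map (completeIntersectionι ![Q, C]) (genericAlgPoint w) ∧
      ∃ (F' : IntermediateField (curveField w) (AlgebraicClosure (curveField w))),
        FiniteDimensional (curveField w) F' ∧
        ∃ (u v y : Fin 9 → F') (α β : F'), LinearIndependent F' ![u, v, y] ∧
          (algebraMap (curveField w) F' ∘ p) = α • u + β • v ∧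
          (∀ c : Fin 3 → F', MvPolynomial.eval (StrongLineCover.comb u v y c)
            (MvPolynomial.map ((algebraMap (curveField w) F').comp (algebraMap K (curveField w))) Q) = 0) ∧
          ∀ c : Fin 3 → F', MvPolynomial.eval (StrongLineCover.comb u v y c)
              (MvPolynomial.map ((algebraMap (curveField w) F').comp (algebraMap K (curveField w))) C) =
            c 2 ^ 3 * MvPolynomial.eval y
              (MvPolynomial.map ((algebraMap (curveField w) F').comp (algebraMap K (curveField w))) C) := by
  obtain ⟨p, hp, hP, hQp, hCp⟩ := exists_coords hQ hC w
  obtain ⟨F', hfd, u, v, y, α, β, hli, hspan, hQv, hCv⟩ :=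
    StrongLineCover.exists_fatFlag_over_finite_extension (F := curveField w) hQ hC hp hQp hCp
  exact ⟨p, hp, hP, F', hfd, u, v, y, α, β, hli, hspan, hQv, hCv⟩

end QuadricCubic

end Literature.AlgebraicGeometry.Motives

end
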